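import Mathlib
import HarnessLib
import Summits.Ventures.LatticeQCDFlow.Scoring.SplitChainCycleFormula

/-!
# Tours of the split chain, VII: the square of a tour sum as one series, two-time moments along
# the first tour (`E[T_{t+d} g₁(X_t) g₂(X_{t+d})] = (1−ε)^{t+d} π(g₁ R^d g₂)` when `ν = π`), and the
# geometric bound on centred autocovariances

HONEST FRAMING: exact (Metropolis-corrected) sampling algorithms for lattice gauge theory;
figures of merit are autocorrelation/cost numbers at stated couplings and volumes; no
continuum-physics claim.

Venture `LatticeQCDFlow` (cell pub-lqcd), topic `Scoring`; FANOUT row 8 (`s0-cpn-nemc`, GEN-16).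
NEW WORK of the cell, not a published result; no definition is introduced.  Preliminaries for
`Scoring/TourVariance.lean` (the tour variance is the Green–Kubo asymptotic variance), for a kernel
minorised by its own invariant law (`κ(x, ·) ≥ ε π`): the residual kernel then leaves `π` invariant
(`Scoring/KernelTransitionOperator.invariant_residualKernel`), so the fresh-start moment formulas of
`Scoring/SplitChainResidualMoves.lean` lose their `R^t`.  Nothing is cited.

## Content (`r = 1 − ε.toReal`; `T_{0,u} = ∏_{i<u} 1{coin_{i+1} = tails} = 1{K_u = 0}`)

* `sq_sum_range_eq_sum` — `(Σ_{u<n} a_u)² = Σ_{u<n} a_u (a_u + 2 Σ_{t<u} a_t)`;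
* `sq_tourSum_zero_eq_tsum` — once tour `0` has ended, `(∑' u, 1{K_u=0} g(X_u))²
  = ∑' u, 1{K_u=0} g(X_u)(g(X_u) + 2Σ_{t<u} g(X_t))`; `tailsProd₀_add` — `T_{0,t+d} = T_{0,t} T_{t,d}`;
* **`splitChain_fresh_tailsPair`** — `E_π̂[T_{0,t+d} · g₁(X_t) · g₂(X_{t+d})] = r^{t+d} · π(g₁ · R^d g₂)`;
* **`abs_autocov_le_of_centred`** — `|∫ f̄ · (kop κ)^[k] f̄ dπ| ≤ C'² r^k` for `π`-centred `|f̄| ≤ C'`.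
-/

noncomputable section

namespace Summit.Ventures.LatticeQCDFlow.Scoring

open MeasureTheory ProbabilityTheory Filter Finset Preorder Literature.Probability.MarkovChains
open scoped ENNReal

/-! ### Algebra and the pathwise square of a tour sum -/

section Pathwise

variable {Ω : Type*}

/-- `(Σ_{u<n} a_u)² = Σ_{u<n} a_u (a_u + 2 Σ_{t<u} a_t)`. -/
theorem sq_sum_range_eq_sum (a : ℕ → ℝ) : ∀ n : ℕ,
    (∑ u ∈ Finset.range n, a u) ^ 2
      = ∑ u ∈ Finset.range n, a u * (a u + 2 * ∑ t ∈ Finset.range u, a t)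
  | 0 => by simp
  | n + 1 => by
    rw [Finset.sum_range_succ, Finset.sum_range_succ, ← sq_sum_range_eq_sum a n]
    ring

/-- **The square of a finished tour sum as one series**: if `K_{t₀} = 0` and `coin_{t₀+1}` heads,
`(∑' u, 1{K_u=0} g(X_u))² = ∑' u, 1{K_u=0} · g(X_u) · (g(X_u) + 2 Σ_{t<u} g(X_t))`. -/
theorem sq_tourSum_zero_eq_tsum (g : Ω → ℝ) (x : ℕ → Ω × Bool) {t₀ : ℕ}
    (ht : (∑ s ∈ Finset.range t₀, (if (x (s + 1)).2 then (1 : ℕ) else 0)) = 0)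
    (hh : (x (t₀ + 1)).2 = true) :
    (∑' u, (if (∑ s ∈ Finset.range u, (if (x (s + 1)).2 then (1 : ℕ) else 0)) = 0
        then (1 : ℝ) else 0) * g (x u).1) ^ 2
      = ∑' u, (if (∑ s ∈ Finset.range u, (if (x (s + 1)).2 then (1 : ℕ) else 0)) = 0
        then (1 : ℝ) else 0) * (g (x u).1 * (g (x u).1 + 2 * ∑ t ∈ Finset.range u, g (x t).1)) := by
  have hK : ∀ u, ((∑ s ∈ Finset.range u, (if (x (s + 1)).2 then (1 : ℕ) else 0)) = 0) ↔ u ≤ t₀ := by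
    intro u
    constructor
    · intro hu
      by_contra h
      have := headCount_pos_of_tourStart x ht hh (show t₀ + 1 ≤ u by omega)
      omega
    · intro hu
      have := headCount_mono x hu
      omega
  have hfin : ∀ (φ : ℕ → ℝ), (∑' u, (if (∑ s ∈ Finset.range u,
      (if (x (s + 1)).2 then (1 : ℕ) else 0)) = 0 then (1 : ℝ) else 0) * φ u)
      = ∑ u ∈ Finset.range (t₀ + 1), φ u := by
    intro φ
    rw [tsum_eq_sum (s := Finset.range (t₀ + 1)) fun u hu => by
      rw [if_neg ((hK u).not.2 (by have := Finset.mem_range.not.1 hu; omega)), zero_mul]]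
    exact Finset.sum_congr rfl fun u hu => by
      rw [if_pos ((hK u).2 (by have := Finset.mem_range.1 hu; omega)), one_mul]
  rw [hfin (fun u => g (x u).1), hfin (fun u => g (x u).1 * (g (x u).1
    + 2 * ∑ t ∈ Finset.range u, g (x t).1)), sq_sum_range_eq_sum]

/-- The tails product splits: `T_{0,t+d} = T_{0,t} · T_{t,d}`. -/
theorem tailsProd₀_add (x : ℕ → Ω × Bool) (t d : ℕ) :
    ∏ i ∈ Finset.range (t + d), (if (x (i + 1)).2 then (0 : ℝ) else 1)
      = (∏ i ∈ Finset.range t, (if (x (i + 1)).2 then (0 : ℝ) else 1))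
        * ∏ i ∈ Finset.range d, (if (x (t + i + 1)).2 then (0 : ℝ) else 1) :=
  Finset.prod_range_add _ _ _

end Pathwise

/-! ### Moments of the fresh split chain when `ν = π` -/

section Moments

variable {Ω : Type*} [MeasurableSpace Ω]
  {κ : Kernel Ω Ω} [IsMarkovKernel κ] {π : Measure Ω} [IsProbabilityMeasure π] {ε : ℝ≥0∞}
  {hmin : ∀ x {B : Set Ω}, MeasurableSet B → ε * π B ≤ κ x B}
  (κs : Kernel (Ω × Bool) (Ω × Bool)) [IsMarkovKernel κs]

/-- **Two-time moments along the first tour**: for bounded measurable `g₁, g₂`,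
`E_π̂[T_{0,t+d} · g₁(X_t) · g₂(X_{t+d})] = r^{t+d} · π(g₁ · R^d g₂)` (`π R = π`). -/
theorem splitChain_fresh_tailsPair (hπ : Kernel.Invariant κ π) (hε : ε < 1)
    (hκs : ∀ p, κs p = (ε • π).map (fun y : Ω => (y, true))
      + ((1 - ε) • Doeblin.residualKernel κ π ε hmin p.1).map (fun y : Ω => (y, false)))
    {g₁ g₂ : Ω → ℝ} (hg₁ : Measurable g₁) (hg₂ : Measurable g₂) {C₁ C₂ : ℝ}
    (hC₁ : ∀ y, |g₁ y| ≤ C₁) (hC₂ : ∀ y, |g₂ y| ≤ C₂) (t d : ℕ) :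
    ∫ x, (∏ i ∈ Finset.range (t + d), (if (x (i + 1)).2 then (0 : ℝ) else 1))
        * g₁ (x t).1 * g₂ (x (t + d)).1
        ∂(Kernel.trajMeasure (X := fun _ : ℕ => Ω × Bool) (π.map (fun y : Ω => (y, true)))
          (fun n : ℕ => κs.comap (fun h : (i : ↥(Finset.Iic n)) → Ω × Bool =>
            h ⟨n, Finset.mem_Iic.2 le_rfl⟩) (measurable_pi_apply _)))
      = (1 - ε.toReal) ^ (t + d)
        * ∫ y, g₁ y * (kop (Doeblin.residualKernel κ π ε hmin))^[d] g₂ y ∂π := by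
  haveI hπt : IsProbabilityMeasure (π.map (fun y : Ω => (y, true))) :=
    Measure.isProbabilityMeasure_map (measurable_tagCoin true).aemeasurable
  haveI := Doeblin.isMarkovKernel_residualKernel (κ := κ) (ν := π) (hmin := hmin) hε
  set P := Kernel.trajMeasure (X := fun _ : ℕ => Ω × Bool) (π.map (fun y : Ω => (y, true)))
      (fun n : ℕ => κs.comap (fun h : (i : ↥(Finset.Iic n)) → Ω × Bool =>
        h ⟨n, Finset.mem_Iic.2 le_rfl⟩) (measurable_pi_apply _)) with hP
  obtain ⟨hmd, hbd⟩ := iterate_kop_bounded_measurable (Doeblin.residualKernel κ π ε hmin) hg₂ hC₂ d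
  have hC₁0 : 0 ≤ C₁ := (abs_nonneg _).trans (hC₁ (Classical.choice (nonempty_of_isProbabilityMeasure π)))
  -- the weight `T_{0,t} · g₁(X_t)` depends on the past up to `t`
  have hGm : Measurable fun x : ℕ → Ω × Bool =>
      (∏ i ∈ Finset.range t, (if (x (i + 1)).2 then (0 : ℝ) else 1)) * g₁ (x t).1 :=
    (measurable_tailsProd₀ t).mul (hg₁.comp (measurable_fst.comp (measurable_pi_apply t)))
  have hGd : DependsOn (fun x : ℕ → Ω × Bool =>
      (∏ i ∈ Finset.range t, (if (x (i + 1)).2 then (0 : ℝ) else 1)) * g₁ (x t).1) (Set.Iic t) := by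
    intro x y hxy
    show _ * _ = _ * _
    rw [hxy t (Set.mem_Iic.2 le_rfl)]
    congr 1
    exact Finset.prod_congr rfl fun i hi => by
      rw [hxy (i + 1) (Set.mem_Iic.2 (by have := Finset.mem_range.1 hi; omega))]
  have hGC : ∀ x : ℕ → Ω × Bool,
      |(∏ i ∈ Finset.range t, (if (x (i + 1)).2 then (0 : ℝ) else 1)) * g₁ (x t).1| ≤ C₁ := fun x => by
    rw [abs_mul, abs_of_nonneg (tailsProd₀_mem t x).1]
    calc _ ≤ 1 * |g₁ (x t).1| := mul_le_mul_of_nonneg_right (tailsProd₀_mem t x).2 (abs_nonneg _)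
      _ ≤ C₁ := by rw [one_mul]; exact hC₁ _
  have step := splitChain_tailsRun_move κs (π.map (fun y : Ω => (y, true))) (κ := κ) (ν := π)
    (hmin := hmin) hε hκs t hGm hGd hGC d hg₂ hC₂
  rw [← hP] at step
  -- the one-time moment from the fresh start
  have hprod : Measurable fun y => g₁ y * (kop (Doeblin.residualKernel κ π ε hmin))^[d] g₂ y :=
    hg₁.mul hmd
  have hprodC : ∀ y, |g₁ y * (kop (Doeblin.residualKernel κ π ε hmin))^[d] g₂ y| ≤ C₁ * C₂ := fun y => by
    rw [abs_mul]; exact mul_le_mul (hC₁ y) (hbd y) (abs_nonneg _) hC₁0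
  have step2 := splitChain_fresh_tailsRun_move κs (κ := κ) (ν := π) (hmin := hmin) hε hκs hprod
    hprodC t
  rw [← hP, integral_iterate_kop _ (invariant_residualKernel hπ hε) hprod hprodC t] at step2
  calc ∫ x, (∏ i ∈ Finset.range (t + d), (if (x (i + 1)).2 then (0 : ℝ) else 1))
        * g₁ (x t).1 * g₂ (x (t + d)).1 ∂P
      = ∫ x, (∏ i ∈ Finset.range t, (if (x (i + 1)).2 then (0 : ℝ) else 1)) * g₁ (x t).1
          * (∏ i ∈ Finset.range d, (if (x (t + i + 1)).2 then (0 : ℝ) else 1))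
          * g₂ (x (t + d)).1 ∂P := integral_congr_ae (ae_of_all _ fun x => by
            beta_reduce; rw [tailsProd₀_add]; ring)
    _ = (1 - ε.toReal) ^ d * ∫ x, (∏ i ∈ Finset.range t, (if (x (i + 1)).2 then (0 : ℝ) else 1))
          * g₁ (x t).1 * (kop (Doeblin.residualKernel κ π ε hmin))^[d] g₂ (x t).1 ∂P := step
    _ = (1 - ε.toReal) ^ d * ((1 - ε.toReal) ^ t
          * ∫ y, g₁ y * (kop (Doeblin.residualKernel κ π ε hmin))^[d] g₂ y ∂π) := by
        rw [← step2]
        congr 1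
        exact integral_congr_ae (ae_of_all _ fun x => by ring)
    _ = _ := by rw [pow_add]; ring

/-- **Exponential bound on the centred autocovariance**: `|∫ f̄ · K^k f̄ dπ| ≤ C'² (1 − e)^k` for
`|f̄| ≤ C'` centred. -/
theorem abs_autocov_le_of_centred (hπ : Kernel.Invariant κ π)
    (hmin : ∀ x {B : Set Ω}, MeasurableSet B → ε * π B ≤ κ x B) (hε : ε < 1) {fb : Ω → ℝ}
    (hfb : Measurable fb) {C' : ℝ} (hC' : ∀ y, |fb y| ≤ C') (hfb0 : ∫ y, fb y ∂π = 0) (k : ℕ) :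
    |∫ y, fb y * (kop κ)^[k] fb y ∂π| ≤ C' ^ 2 * (1 - ε.toReal) ^ k := by
  haveI := Doeblin.isMarkovKernel_residualKernel (κ := κ) (ν := π) (hmin := hmin) hε
  have hr : (1 - ε).toReal = 1 - ε.toReal := by
    rw [ENNReal.toReal_sub_of_le hε.le ENNReal.one_ne_top, ENNReal.toReal_one]
  have hr0 : 0 ≤ 1 - ε.toReal := by
    have := (ENNReal.toReal_lt_toReal (ne_top_of_lt hε) ENNReal.one_ne_top).2 hε
    rw [ENNReal.toReal_one] at this; linarith
  have hC'0 : 0 ≤ C' := (abs_nonneg _).trans (hC' (Classical.choice (nonempty_of_isProbabilityMeasure π)))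
  obtain ⟨-, hb⟩ := iterate_kop_bounded_measurable (Doeblin.residualKernel κ π ε hmin) hfb hC' k
  rw [iterate_kop_eq_of_centred (κ := κ) (π := π) (hmin := hmin) hπ hε hfb hC' hfb0 k]
  simp only [hr]
  calc |∫ y, fb y * ((1 - ε.toReal) ^ k * (kop (Doeblin.residualKernel κ π ε hmin))^[k] fb y) ∂π|
      = ‖∫ y, fb y * ((1 - ε.toReal) ^ k * (kop (Doeblin.residualKernel κ π ε hmin))^[k] fb y) ∂π‖ :=
        (Real.norm_eq_abs _).symm
    _ ≤ C' ^ 2 * (1 - ε.toReal) ^ k * π.real Set.univ := by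
        refine norm_integral_le_of_norm_le_const (Eventually.of_forall fun y => ?_)
        rw [Real.norm_eq_abs, abs_mul, abs_mul, abs_of_nonneg (pow_nonneg hr0 k)]
        calc |fb y| * ((1 - ε.toReal) ^ k * |(kop (Doeblin.residualKernel κ π ε hmin))^[k] fb y|)
            ≤ C' * ((1 - ε.toReal) ^ k * C') := mul_le_mul (hC' y)
              (mul_le_mul_of_nonneg_left (hb y) (pow_nonneg hr0 k)) (by positivity) hC'0
          _ = C' ^ 2 * (1 - ε.toReal) ^ k := by ring
    _ = C' ^ 2 * (1 - ε.toReal) ^ k := by rw [probReal_univ, mul_one]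

end Moments

end Summit.Ventures.LatticeQCDFlow.Scoring

end
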